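import Literature.NumberTheory.Sieve.FordMaynardFramework
import Literature.Combinatorics.Enumerative.SetFunctionConvolution
import Mathlib.Algebra.BigOperators.Fin
import Mathlib.MeasureTheory.Integral.Bochner.Set
import Mathlib.MeasureTheory.Constructions.Pi
import Mathlib.MeasureTheory.Measure.Lebesgue.Basic
import HarnessLib

/-!
# Ford–Maynard: the region `ℛ(P)`, coagulations, the class `𝔉_η(P)`, and the fragmentation relation (Theorem 6.4)

Statement layer, continuing `FordMaynardFramework.lean`, for the construction half of K. Ford,
J. Maynard, *On the theory of prime producing sieves* (arXiv:2407.14368, 2024), §§4.1, 6: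

* `NoProperSubsumIn θ ν x`, `InFundRegion γ θ ν k x` — the fundamental region `ℛ(P)`,
  `P = (γ, θ, ν)` (Definition 4.3: vectors with components in `(0, 1 − γ)`, sum `1`, and no proper
  subsum in `[θ, θ + ν]`); `IsCoagulationOf x y` (Definition 4.5: `y = (|x_{A_1}|, …, |x_{A_h}|)` for a
  decomposition of `x` into non-empty subvectors, encoded by a surjection of index sets) and
  `InCoagFundRegion γ θ ν k y` — `y ∈ 𝒞(ℛ(P))`; proved API (sums, positivity, transitivity, and
  "coagulation does not create proper subsums in `[θ, θ+ν]`").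
* `MemTypeI η γ θ ν f` — `f ∈ 𝔉_η(P)` (Definition 6.2 (a), (b), (c)), the class of Theorem 6.3;
  `MemTypeI.toStar`: `𝔉_η(P) ⊆ 𝔉*_η(γ)` (`MemTypeIStar` of the framework file).
* `fragOp γ η g` — the right-hand side of the ("alternative", all components fragmented)
  **fragmentation relation** (6.3) of §6.1, as an operator on functions on vectors:
  `fragOp γ η g (ξ₁,…,ξ_m) = ξ₁⋯ξ_m ∑_{k₁,…,k_m ≥ 1} ∫ ∏_j 𝓛_{1−γ}(u_j)/(k_j! u_{j,1}⋯u_{j,k_j}) ·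
  g(u₁,…,u_m) du`, the integral over the fragmentations `u_j ∈ (0,∞)^{k_j}`, `|u_j| = ξ_j`, all
  `u_{j,i} ≥ η`, in the projection measures (§4.2), with UNORDERED blocks and the compensating
  factors `1/k_j!` (the convention of (Tzero), §6.1) — written as ONE Lebesgue integral over the flat
  coordinate space `ℝ^{Fin m × Fin N}`, `N = ⌊1/η⌋` (block `j` uses `k_j − 1` free coordinates, its
  last coordinate is `ξ_j −` their sum, and the unused coordinates are dummies integrated over
  `(0, 1)`), see `fragIntegrand`; `𝓛_c` is the Linnik function `linnikFn` of
  `Literature/Combinatorics/Enumerative/SetFunctionConvolution.lean` (Lemmas 5.4, 5.5 proved there).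
  `FragRel γ η f`: `f = fragOp γ η f` on the vectors with components `≥ η` summing to `1`.
* Named facts: `FordMaynardFragmentation` — **Theorem 6.4** ((TypeI-f) ⇔ fragmentation relation);
  `FordMaynardFragmentationPiecewiseLipschitz` — the (fsl)-extension of piecewise-Lipschitz data is
  piecewise Lipschitz (used implicitly in the proofs of Theorems 6.3 and 9.1).
* Proved API for `fragOp`: `fragOp_apply_of_small` (`fragOp γ η g (ξ) = g(ξ)` when all
  `ξ_j ∈ [η, 1 − γ)`: only the term with all `k_j = 1` survives, Lemma 5.5 (b)), `fragOp_congr`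
  (only the values of `g` at vectors with all components in `[η, 1 − γ)` enter, Lemma 5.5 (a)),
  `exists_isCoagulationOf_of_fragOp_ne_zero` (support: `fragOp γ η g (ξ) ≠ 0` forces all
  `ξ_j ≥ η` and `g ≠ 0` at some fragmentation of `ξ` with pieces `≥ η`).

What (6.3)/(fsl) say. For `f ∈ 𝔉_η` and `ξ ∈ 𝒞(ℛ(P))` with all `ξ_i ≥ η`:
`f(ξ)/(ξ₁⋯ξ_m) = ∑_{k₁,…,k_m ≥ 1} ∫_{ξ_j = u_{j,1}+⋯+u_{j,k_j}, η ≤ u_{j,1} < ⋯ < u_{j,k_j}}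
 𝓛_{1−γ}(u₁)⋯𝓛_{1−γ}(u_m) f(u₁,…,u_m)/(u_{1,1}⋯u_{m,k_m}) du₁⋯du_m` [(6.3)]; since
`𝓛_{1−γ}(u_j) = 𝟙(k_j = 1)` when `ξ_j < 1 − γ` and `𝓛_{1−γ}(ξ_j) = 0` when `ξ_j ≥ 1 − γ` (Lemma 5.5),
only the components `≥ 1 − γ` are genuinely fragmented, into `k_j ≥ 2` pieces `< 1 − γ`, which is the
printed "fragmentation relation" (fsl) of Theorem 6.4 ("this follows quickly from Lemma 5.5 (a) and
(b)", §6.1). Consequently the values of `f` at vectors with a component `≥ 1 − γ` are determined by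
its values at vectors with all components `< 1 − γ`, and conversely arbitrary such data extend, by
(fsl), to a function satisfying (TypeI-f) ("This is, in fact, how we shall proceed", after Theorem 6.4).

Design notes. (1) Theorem 6.4 is printed for `f ∈ 𝒮` satisfying (a), (b) of Definition 6.2 for
`𝔉_η(P)`; its proof (§6.1) uses of (a) only "bounded, supported on vectors with components `≥ η`
(summing to `1`)", and §9 applies it to the `ν = 0` class `𝔉*_η(γ)` (proof of Theorem 9.1, the
function `f̃`); the fact is transcribed with this weaker support hypothesis, which covers both uses.
(2) The flat encoding of the iterated slice integrals is chosen so that linearity in `g`, the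
symmetry of `fragOp γ η g` in `ξ` (a permutation of blocks is a permutation of coordinates) and
measure estimates are statements about a single integral on a fixed product space. (3) Nothing here
is specific to `P`: `fragOp` depends on `γ, η` only, as (fsl) does.

## References

* K. Ford, J. Maynard, *On the theory of prime producing sieves*, arXiv:2407.14368v1 (2024): §4.1
  Definitions 4.2–4.5; §4.2 (projection measures); §5.2 (Linnik function (5.2), Lemmas 5.4, 5.5);
  §6 Definitions 6.1–6.2, Theorems 6.3–6.4, §6.1 ((6.3), (Tzero)), §6.2 (the tweak `h`, "h ∈ 𝔉_η");
  §9 (proof of Theorem 9.1, "f̃ ∈ 𝔉_η(P)"). (`lit read arxiv:2407.14368`, chunks 12, 17–18, 22–26,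
  50.) [FordMaynard2024PrimeSieves]
-/

noncomputable section

open MeasureTheory Finset

namespace Literature.NumberTheory.Sieve.FordMaynard

/-! ### Proper subsums and the fundamental region `ℛ(P)` (Definitions 4.2, 4.3) -/

/-- `x ∈ ℝ^k` has **no proper subsum in `[θ, θ + ν]`**: for every index set `A` with `0 < |A| < k`
the subsum `|x_A| = ∑_{i ∈ A} x_i` lies outside `[θ, θ + ν]` (Definition 4.2: proper subsums;
Definition 4.3). [cite: FordMaynard2024PrimeSieves, Definitions 4.2–4.3] -/
def NoProperSubsumIn (θ ν : ℝ) {k : ℕ} (x : Fin k → ℝ) : Prop :=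
  ∀ A : Finset (Fin k), A.Nonempty → A ≠ Finset.univ →
    ∑ i ∈ A, x i < θ ∨ θ + ν < ∑ i ∈ A, x i

/-- **The fundamental region `ℛ(P)`**, `P = (γ, θ, ν)` (Definition 4.3): `x ∈ ℝ^k` (any `k`) lies in
`ℛ(P)` iff its components lie in `(0, 1 − γ)`, sum to `1`, and `x` has no proper subsum in
`[θ, θ + ν]`. [cite: FordMaynard2024PrimeSieves, Definition 4.3] -/
def InFundRegion (γ θ ν : ℝ) (k : ℕ) (x : Fin k → ℝ) : Prop :=
  (∀ i, 0 < x i ∧ x i < 1 - γ) ∧ ∑ i, x i = 1 ∧ NoProperSubsumIn θ ν x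

/-! ### Coagulations (Definitions 4.4, 4.5) -/

/-- **`y` is a coagulation of `x`** (equivalently `x` is a fragmentation of `y`, Definition 4.5):
there is a decomposition `x_{A_1} ⊔ ⋯ ⊔ x_{A_k} = x` into non-empty subvectors (Definition 4.4) with
`y_j = |x_{A_j}|` for all `j`; the decomposition is encoded by the surjection `c : Fin n → Fin k`,
`A_j = c⁻¹(j)`. [cite: FordMaynard2024PrimeSieves, Definitions 4.4–4.5] -/
def IsCoagulationOf {n k : ℕ} (x : Fin n → ℝ) (y : Fin k → ℝ) : Prop :=
  ∃ c : Fin n → Fin k, Function.Surjective c ∧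
    ∀ j, y j = ∑ i ∈ Finset.univ.filter (fun i => c i = j), x i

/-- **`y ∈ 𝒞(ℛ(P))`**: `y` is a coagulation of some vector of `ℛ(P)` (Definition 4.5: `𝒞(ℛ)` is the
set of all coagulations of all vectors in `ℛ`). [cite: FordMaynard2024PrimeSieves, Definition 4.5] -/
def InCoagFundRegion (γ θ ν : ℝ) (k : ℕ) (y : Fin k → ℝ) : Prop :=
  ∃ (n : ℕ) (x : Fin n → ℝ), InFundRegion γ θ ν n x ∧ IsCoagulationOf x y

namespace IsCoagulationOf

variable {n k l : ℕ} {x : Fin n → ℝ} {y : Fin k → ℝ} {z : Fin l → ℝ}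

/-- Every vector is a coagulation of itself (the decomposition into singletons). [folklore] -/
theorem refl (x : Fin n → ℝ) : IsCoagulationOf x x := by
  refine ⟨id, Function.surjective_id, fun j => ?_⟩
  symm
  refine Finset.sum_eq_single_of_mem j (by simp) fun i hi hij => ?_
  simp only [Finset.mem_filter, Finset.mem_univ, true_and, id_eq] at hi
  exact absurd hi hij

/-- Coagulation preserves the sum of the components. [cite: FordMaynard2024PrimeSieves, Definition 4.5] -/
theorem sum_eq (h : IsCoagulationOf x y) : ∑ j, y j = ∑ i, x i := by
  obtain ⟨c, _, hc⟩ := h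
  simp_rw [hc]
  exact Finset.sum_fiberwise_of_maps_to (fun i _ => Finset.mem_univ (c i)) x

/-- A coagulation of a coagulation is a coagulation (`𝒞(𝒞(ℛ)) = 𝒞(ℛ)`). [folklore] -/
theorem trans (hxy : IsCoagulationOf x y) (hyz : IsCoagulationOf y z) : IsCoagulationOf x z := by
  obtain ⟨c, hc, hcy⟩ := hxy
  obtain ⟨d, hd, hdz⟩ := hyz
  refine ⟨d ∘ c, hd.comp hc, fun l' => ?_⟩
  rw [hdz l']
  have : ∀ j ∈ Finset.univ.filter (fun j => d j = l'),
      y j = ∑ i ∈ Finset.univ.filter (fun i => c i = j), x i := fun j _ => hcy j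
  rw [Finset.sum_congr rfl this, ← Finset.sum_biUnion]
  · refine Finset.sum_congr ?_ fun _ _ => rfl
    ext i
    simp
  · intro j _ j' _ hjj'
    simp only [Function.onFun]
    rw [Finset.disjoint_filter]
    intro i _ h1 h2
    exact hjj' (h1.symm.trans h2)

/-- The components of a coagulation of a vector with positive components are positive.
[folklore] -/
theorem pos (h : IsCoagulationOf x y) (hx : ∀ i, 0 < x i) (j : Fin k) : 0 < y j := by
  obtain ⟨c, hc, hcy⟩ := h
  rw [hcy j]
  obtain ⟨i, hi⟩ := hc j
  refine Finset.sum_pos (fun i _ => hx i) ⟨i, ?_⟩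
  simp [hi]

/-- Every component of `x` is bounded by the component of the coagulation `y` it is merged into;
in particular a lower bound for the components of `x` is one for those of `y`. [folklore] -/
theorem le_of_forall_le (h : IsCoagulationOf x y) (hx : ∀ i, 0 ≤ x i) {η : ℝ} (hη : ∀ i, η ≤ x i)
    (j : Fin k) : η ≤ y j := by
  obtain ⟨c, hc, hcy⟩ := h
  rw [hcy j]
  obtain ⟨i, hi⟩ := hc j
  have hi' : i ∈ Finset.univ.filter (fun i => c i = j) := by simp [hi]
  exact (hη i).trans (Finset.single_le_sum (fun i' _ => hx i') hi')

/-- **Coagulation creates no new proper subsums**: a proper subsum of a coagulation `y` of `x` is a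
proper subsum of `x`; hence if `x` has no proper subsum in `[θ, θ + ν]`, neither has `y`.
[cite: FordMaynard2024PrimeSieves, §5.3 (proof of Lemma 5.8)] -/
theorem noProperSubsumIn {θ ν : ℝ} (h : IsCoagulationOf x y) (hx : NoProperSubsumIn θ ν x) :
    NoProperSubsumIn θ ν y := by
  obtain ⟨c, hc, hcy⟩ := h
  intro A hA hAu
  set B : Finset (Fin n) := Finset.univ.filter (fun i => c i ∈ A) with hB
  have hsum : ∑ j ∈ A, y j = ∑ i ∈ B, x i := by
    rw [Finset.sum_congr rfl fun j _ => hcy j, ← Finset.sum_biUnion]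
    · refine Finset.sum_congr ?_ fun _ _ => rfl
      ext i; simp [hB]
    · intro j _ j' _ hjj'
      simp only [Function.onFun]
      rw [Finset.disjoint_filter]
      intro i _ h1 h2
      exact hjj' (h1.symm.trans h2)
  have hBne : B.Nonempty := by
    obtain ⟨j, hj⟩ := hA
    obtain ⟨i, hi⟩ := hc j
    exact ⟨i, by simp [hB, hi, hj]⟩
  have hBu : B ≠ Finset.univ := by
    intro hBu'
    apply hAu
    refine Finset.eq_univ_of_forall fun j => ?_
    obtain ⟨i, hi⟩ := hc j
    have : i ∈ B := hBu' ▸ Finset.mem_univ i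
    simpa [hB, hi] using this
  rw [hsum]
  exact hx B hBne hBu

end IsCoagulationOf

namespace InFundRegion

variable {γ θ ν : ℝ} {k : ℕ} {x : Fin k → ℝ}

/-- `ℛ(P) ⊆ 𝒞(ℛ(P))`. [folklore] -/
theorem inCoagFundRegion (h : InFundRegion γ θ ν k x) : InCoagFundRegion γ θ ν k x :=
  ⟨k, x, h, IsCoagulationOf.refl x⟩

end InFundRegion

namespace InCoagFundRegion

variable {γ θ ν : ℝ} {k : ℕ} {y : Fin k → ℝ}

/-- The components of a vector of `𝒞(ℛ(P))` sum to `1`. [cite: FordMaynard2024PrimeSieves, Definitions 4.3, 4.5] -/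
theorem sum_eq_one (h : InCoagFundRegion γ θ ν k y) : ∑ j, y j = 1 := by
  obtain ⟨n, x, hx, hxy⟩ := h
  rw [hxy.sum_eq, hx.2.1]

/-- The components of a vector of `𝒞(ℛ(P))` are positive. [cite: FordMaynard2024PrimeSieves, Definitions 4.3, 4.5] -/
theorem pos (h : InCoagFundRegion γ θ ν k y) (j : Fin k) : 0 < y j := by
  obtain ⟨n, x, hx, hxy⟩ := h
  exact hxy.pos (fun i => (hx.1 i).1) j

/-- A vector of `𝒞(ℛ(P))` has no proper subsum in `[θ, θ + ν]`.
[cite: FordMaynard2024PrimeSieves, §5.3 (proof of Lemma 5.8)] -/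
theorem noProperSubsumIn (h : InCoagFundRegion γ θ ν k y) : NoProperSubsumIn θ ν y := by
  obtain ⟨n, x, hx, hxy⟩ := h
  exact hxy.noProperSubsumIn hx.2.2

/-- `𝒞(𝒞(ℛ(P))) = 𝒞(ℛ(P))`: a coagulation of a vector of `𝒞(ℛ(P))` lies in `𝒞(ℛ(P))`. [folklore] -/
theorem of_isCoagulationOf {l : ℕ} {z : Fin l → ℝ} (h : InCoagFundRegion γ θ ν k y)
    (hyz : IsCoagulationOf y z) : InCoagFundRegion γ θ ν l z := by
  obtain ⟨n, x, hx, hxy⟩ := h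
  exact ⟨n, x, hx, hxy.trans hyz⟩

end InCoagFundRegion

/-! ### The class `𝔉_η(P)` (Definition 6.2) -/

/-- **`f ∈ 𝔉_η(P)`**, `P = (γ, θ, ν)` (Definition 6.2): `f ∈ 𝒮` (Definition 6.1) such that
(a) `f` is supported on the vectors of `𝒞(ℛ(P))` all of whose components are `≥ η`, and is
bounded; (b) for each `k` the restriction of `f` to `ℝ^k` is a finite sum of functions each
supported on a convex polytope and Lipschitz on it (`IsPiecewiseLipschitz`); (c) `f` satisfies
(TypeI-f) with parameter `γ` (`TypeIIdentity`). This is the hypothesis class of Theorem 6.3.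
[cite: FordMaynard2024PrimeSieves, Definition 6.2] -/
structure MemTypeI (η γ θ ν : ℝ) (f : VecFn) : Prop where
  symm : f.IsSymmetric
  support : ∀ (k : ℕ) (ξ : Fin k → ℝ), f k ξ ≠ 0 → InCoagFundRegion γ θ ν k ξ ∧ ∀ i, η ≤ ξ i
  bounded : ∃ F : ℝ, ∀ (k : ℕ) (ξ : Fin k → ℝ), |f k ξ| ≤ F
  piecewiseLipschitz : ∀ k : ℕ, IsPiecewiseLipschitz (f k)
  typeI : TypeIIdentity γ f

namespace MemTypeI

variable {η γ θ ν : ℝ} {f : VecFn}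

/-- `𝔉_η(P) ⊆ 𝔉*_η(γ)`: the vectors of `𝒞(ℛ(P))` have components summing to `1`, so a function
of `𝔉_η(P)` satisfies the support condition of the `ν = 0` class of §9.
[cite: FordMaynard2024PrimeSieves, §9 (definition of 𝔉*_η(γ))] -/
theorem toStar (hf : MemTypeI η γ θ ν f) : MemTypeIStar η γ f where
  symm := hf.symm
  support k ξ h := ⟨(hf.support k ξ h).2, (hf.support k ξ h).1.sum_eq_one⟩
  bounded := hf.bounded
  piecewiseLipschitz := hf.piecewiseLipschitz
  typeI := hf.typeI

/-- A function of `𝔉_η(P)` vanishes at every vector having a proper subsum in `[θ, θ + ν]`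
(its support lies in `𝒞(ℛ(P))`). [cite: FordMaynard2024PrimeSieves, Definition 6.2 (a)] -/
theorem eq_zero_of_subsum (hf : MemTypeI η γ θ ν f) {k : ℕ} {ξ : Fin k → ℝ} {A : Finset (Fin k)}
    (hA : A.Nonempty) (hAu : A ≠ Finset.univ) (h1 : θ ≤ ∑ i ∈ A, ξ i)
    (h2 : ∑ i ∈ A, ξ i ≤ θ + ν) : f k ξ = 0 := by
  by_contra h
  rcases (hf.support k ξ h).1.noProperSubsumIn A hA hAu with h' | h' <;> linarith

end MemTypeI

/-! ### The fragmentation operator ((6.3), (fsl)) -/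

/-- The maximal number of pieces of a fragmentation with pieces `≥ η` of a component `≤ 1`:
`N = ⌊1/η⌋`. [cite: FordMaynard2024PrimeSieves, §6 (remark after Definition 6.2)] -/
def maxBlock (η : ℝ) : ℕ := ⌊1 / η⌋₊

/-- The block (fragment) of size `k` and component sum `α` read off a sequence `u` of flat
coordinates: its first `k − 1` components are `u₀, …, u_{k−2}` and its last one is
`α − (u₀ + ⋯ + u_{k−2})` — the parametrisation of the slice `{v ∈ ℝ^k : |v| = α}` by its first
`k − 1` coordinates (projection measure, §4.2). [cite: FordMaynard2024PrimeSieves, §4.2 (Notational convention)] -/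
def blockVec (k : ℕ) (α : ℝ) (u : ℕ → ℝ) : Fin k → ℝ :=
  fun i => if (i : ℕ) + 1 < k then u i else α - ∑ i' ∈ Finset.range (k - 1), u i'

/-- Row `j` of a point of the flat coordinate space `ℝ^{Fin m × Fin N}`, as a sequence (extended by
`0` beyond `N`). [folklore] -/
def rowOf {m N : ℕ} (U : Fin m × Fin N → ℝ) (j : Fin m) : ℕ → ℝ :=
  fun i => if h : i < N then U (j, ⟨i, h⟩) else 0

/-- Admissibility of the block of size `k`, sum `α`, read off the row `u` (with `N` coordinates):
the `k − 1` free coordinates are positive with sum `< α` (so the block lies in the open slice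
`(0,∞)^k ∩ {|v| = α}`), the unused coordinates `u_{k−1}, …, u_{N−1}` are dummies in `(0, 1)`
(contributing a factor `1` to the integral), and every component of the block is `≥ η` (the
constraint `η ≤ u_{j,i}` of (6.3)/(fsl)). [cite: FordMaynard2024PrimeSieves, §6.1 (6.3)] -/
def BlockCond (η : ℝ) (N k : ℕ) (α : ℝ) (u : ℕ → ℝ) : Prop :=
  (∀ i, i + 1 < k → 0 < u i) ∧ (∑ i ∈ Finset.range (k - 1), u i < α) ∧
    (∀ i, k - 1 ≤ i → i < N → 0 < u i ∧ u i < 1) ∧ ∀ i : Fin k, η ≤ blockVec k α u i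

/-- The weight of a block `v ∈ ℝ^k` in (6.3), unordered form: `𝓛_{1−γ}(v)/(k! · v₁⋯v_k)`, with
the Linnik function `𝓛_c` of (5.2) (`linnikFn`) and the factor `1/k!` compensating for leaving the
pieces unordered ((Tzero), §6.1). [cite: FordMaynard2024PrimeSieves, §6.1 (6.3) and (Tzero)] -/
def blockWeight (γ : ℝ) (k : ℕ) (v : Fin k → ℝ) : ℝ :=
  Literature.Combinatorics.Enumerative.linnikFn (1 - γ) v Finset.univ /
    ((k.factorial : ℝ) * ∏ i, v i)

/-- Concatenation `(v₁, …, v_m) ∈ ℝ^{k₁ + ⋯ + k_m}` of blocks `v_j ∈ ℝ^{k_j}` (Definition 4.1), via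
the standard enumeration `finSigmaFinEquiv : (Σ j, Fin k_j) ≃ Fin (∑ k_j)` (block after block, each
in order). [cite: FordMaynard2024PrimeSieves, Definition 4.1] -/
def concatBlocks {m : ℕ} (kv : Fin m → ℕ) (v : (j : Fin m) → Fin (kv j) → ℝ) :
    Fin (∑ j, kv j) → ℝ :=
  fun t => v ((finSigmaFinEquiv (n := kv)).symm t).1 ((finSigmaFinEquiv (n := kv)).symm t).2

open scoped Classical in
/-- The integrand of the `(k₁, …, k_m)`-term of (6.3) at `ξ ∈ ℝ^m`, on the flat coordinates
`U ∈ ℝ^{Fin m × Fin N}`: if every block `u_j = blockVec k_j ξ_j (row j of U)` is admissible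
(`BlockCond`), it is `∏_j 𝓛_{1−γ}(u_j)/(k_j! ∏_i u_{j,i}) · g(u₁, …, u_m)`, and `0` otherwise.
[cite: FordMaynard2024PrimeSieves, §6.1 (6.3)] -/
def fragIntegrand (γ η : ℝ) (N : ℕ) (g : VecFn) {m : ℕ} (kv : Fin m → ℕ) (ξ : Fin m → ℝ)
    (U : Fin m × Fin N → ℝ) : ℝ :=
  if ∀ j, BlockCond η N (kv j) (ξ j) (rowOf U j) then
    (∏ j, blockWeight γ (kv j) (blockVec (kv j) (ξ j) (rowOf U j))) *
      g (∑ j, kv j) (concatBlocks kv (fun j => blockVec (kv j) (ξ j) (rowOf U j)))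
  else 0

/-- **The fragmentation operator** (right-hand side of (6.3), times `ξ₁⋯ξ_m`): for a function `g`
on vectors and `ξ ∈ ℝ^m`,
`fragOp γ η g (ξ) = ξ₁⋯ξ_m · ∑_{1 ≤ k₁,…,k_m ≤ N} ∫_{U ∈ ℝ^{Fin m × Fin N}} fragIntegrand`, i.e.
`ξ₁⋯ξ_m ∑_{k} ∫ ∏_j 𝓛_{1−γ}(u_j)/(k_j! ∏ u_{j,i}) g(u₁,…,u_m)`, the `u_j` ranging over the unordered
fragmentations of `ξ_j` into `k_j` pieces `≥ η` (projection measures), `N = ⌊1/η⌋` (pieces `≥ η` of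
a component `≤ 1` number at most `N`; functions of the classes considered vanish at vectors with a
component `> 1`). For `g ∈ 𝒮` this is the printed ordered form. By Lemma 5.5, blocks of size `1` and
value `< 1 − γ` have weight `1/ξ_j` and blocks containing a piece `≥ 1 − γ` have weight `0`, so
`fragOp γ η g (ξ) = g(ξ)` when all `ξ_j ∈ [η, 1 − γ)`, and in general only the values of `g` at vectors
with all components in `[η, 1 − γ)` enter: `fragOp γ η g` is the (fsl)-extension of these values.
[cite: FordMaynard2024PrimeSieves, §6.1 (6.3); Theorem 6.4 (fsl)] -/
def fragOp (γ η : ℝ) (g : VecFn) : VecFn := fun m ξ =>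
  (∏ j, ξ j) * ∑ kv ∈ Fintype.piFinset (fun _ : Fin m => Finset.Icc 1 (maxBlock η)),
    ∫ U : Fin m × Fin (maxBlock η) → ℝ, fragIntegrand γ η (maxBlock η) g kv ξ U

/-- **The fragmentation relation** for `f` (the alternative form (6.3) of (fsl), all components
fragmented): `f(ξ) = fragOp γ η f (ξ)` for every vector `ξ` with all components `≥ η` summing to `1`.
(On vectors with all components `< 1 − γ` this is automatic; (fsl) is its content on the others.)
[cite: FordMaynard2024PrimeSieves, Theorem 6.4 and §6.1 (6.3)] -/
def FragRel (γ η : ℝ) (f : VecFn) : Prop :=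
  ∀ (m : ℕ) (ξ : Fin m → ℝ), (∀ i, η ≤ ξ i) → ∑ i, ξ i = 1 → f m ξ = fragOp γ η f m ξ

/-! ### Theorem 6.4 and the piecewise-Lipschitz property of extensions, as named facts -/

/-- **Ford–Maynard, Theorem 6.4** (the fragmentation relation). Let `0 < γ < 1`, `η > 0`, and let
`f ∈ 𝒮` be bounded, supported on vectors with all components `≥ η` summing to `1`, with every
restriction `f|ℝ^k` piecewise Lipschitz on convex polytopes (Definition 6.2 (b)). Then `f` satisfies
(TypeI-f) with parameter `γ` if and only if it satisfies the fragmentation relation: for all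
`s ≥ 0`, `ℓ ≥ 1`, `β_i ∈ [η, 1 − γ)`, `α_j ≥ 1 − γ` with `|β| + |α| = 1`,
`f(β, α) = α₁⋯α_ℓ ∑_{k₁,…,k_ℓ ≥ 2} ∫ 𝓛_{1−γ}(u₁)⋯𝓛_{1−γ}(u_ℓ) f(β, u₁, …, u_ℓ)/∏ u_{j,h} du`
(fsl), here in the equivalent all-components form (6.3) (`FragRel`, unordered blocks with `1/k_j!`).
Printed for `f` satisfying (a), (b) of Definition 6.2 (support in `𝒞(ℛ(P))`); the proof (§6.1:
(Tzero) from (TypeI-f) block by block; conversely symmetrisation and Lemma 5.4 with `m = 1`) uses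
only the support hypothesis stated here, and §9 uses the theorem for the class `𝔉*_η(γ)` (proof of
Theorem 9.1). [cite: FordMaynard2024PrimeSieves, Theorem 6.4] -/
def FordMaynardFragmentation : Prop :=
  ∀ γ η : ℝ, 0 < γ → γ < 1 → 0 < η → ∀ f : VecFn, f.IsSymmetric →
    (∃ F : ℝ, ∀ (k : ℕ) (ξ : Fin k → ℝ), |f k ξ| ≤ F) →
    (∀ (k : ℕ) (ξ : Fin k → ℝ), f k ξ ≠ 0 → (∀ i, η ≤ ξ i) ∧ ∑ i, ξ i = 1) →
    (∀ k : ℕ, IsPiecewiseLipschitz (f k)) →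
      (TypeIIdentity γ f ↔ FragRel γ η f)

/-- **Extensions by (fsl) are piecewise Lipschitz.** If every restriction `g|ℝ^k` of the data `g`
is piecewise Lipschitz on convex polytopes (Definition 6.2 (b)), then so is every restriction of
its (fsl)-extension `fragOp γ η g`. Ford–Maynard use this implicitly each time a function is
defined by (fsl) from piecewise-Lipschitz data and then treated as a member of `𝔉_η`: the tweak `h`
in the proof of Theorem 6.3 ("By Theorem 6.4, (TypeI-f) holds for `h`; that is, `h ∈ 𝔉_η`", §6.2,
where (b) for `h` is then used to apply Lemma 5.11), and `f̃` in the proof of Theorem 9.1 ("Then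
`f̃ ∈ 𝔉_η(P)` since `𝒟_{k,η}(P)` is a finite union of convex polytopes", §9). (Mechanism: the
integrand of `fragOp` is, on finitely many convex polytopes of `(ξ, U)`-space, Lipschitz and
bounded; fibre volumes of polytopes are Lipschitz in the base point away from the finitely many
hyperplanes where a constraint is independent of the fibre variable.)
[cite: FordMaynard2024PrimeSieves, §6.2 (proof of Theorem 6.3 (a)) and §9 (proof of Theorem 9.1)] -/
def FordMaynardFragmentationPiecewiseLipschitz : Prop :=
  ∀ γ η : ℝ, 0 < γ → γ < 1 → 0 < η → ∀ g : VecFn, (∀ k : ℕ, IsPiecewiseLipschitz (g k)) →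
    ∀ m : ℕ, IsPiecewiseLipschitz (fragOp γ η g m)

/-! ### First properties of blocks -/

/-- The components of `blockVec k α u` sum to `α` (for `k ≥ 1`). [folklore] -/
theorem sum_blockVec {k : ℕ} (hk : 1 ≤ k) (α : ℝ) (u : ℕ → ℝ) : ∑ i, blockVec k α u i = α := by
  obtain ⟨k', rfl⟩ : ∃ k', k = k' + 1 := ⟨k - 1, by omega⟩
  rw [Fin.sum_univ_castSucc]
  have h1 : ∀ i : Fin k', blockVec (k' + 1) α u (Fin.castSucc i) = u i := by
    intro i
    simp only [blockVec, Fin.val_castSucc]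
    rw [if_pos (by omega)]
  have h2 : blockVec (k' + 1) α u (Fin.last k') = α - ∑ i' ∈ Finset.range k', u i' := by
    simp only [blockVec, Fin.val_last, lt_self_iff_false, if_false]
    simp
  rw [Finset.sum_congr rfl fun i _ => h1 i, h2, Fin.sum_univ_eq_sum_range]
  ring

/-- A block of size `1` and sum `α` is the vector `(α)`. [folklore] -/
theorem blockVec_one (α : ℝ) (u : ℕ → ℝ) : blockVec 1 α u = fun _ => α := by
  funext i
  simp [blockVec]

/-- Under `BlockCond`, every component of the block is `≥ η`. [folklore] -/
theorem BlockCond.le_blockVec {η : ℝ} {N k : ℕ} {α : ℝ} {u : ℕ → ℝ} (h : BlockCond η N k α u)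
    (i : Fin k) : η ≤ blockVec k α u i :=
  h.2.2.2 i

/-- Under `BlockCond`, every component of the block is positive. [folklore] -/
theorem BlockCond.blockVec_pos {η : ℝ} {N k : ℕ} {α : ℝ} {u : ℕ → ℝ} (h : BlockCond η N k α u)
    (i : Fin k) : 0 < blockVec k α u i := by
  simp only [blockVec]
  split_ifs with hi
  · exact h.1 i hi
  · linarith [h.2.1]


/-! ### Basic properties of the fragmentation operator -/

/-- Changing the dimension index along an equality and transporting the vector by `Fin.cast`
does not change the value of a function on vectors. [folklore] -/
theorem VecFn.apply_congr (g : VecFn) {n n' : ℕ} (h : n = n') (v : Fin n → ℝ) (v' : Fin n' → ℝ)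
    (hv : ∀ i, v i = v' (Fin.cast h i)) : g n v = g n' v' := by
  subst h
  congr
  funext i
  simpa using hv i

/-- The entries of a concatenation are the entries of its blocks. [folklore] -/
theorem concatBlocks_apply_equiv {m : ℕ} (kv : Fin m → ℕ) (v : (j : Fin m) → Fin (kv j) → ℝ)
    (p : (j : Fin m) × Fin (kv j)) :
    concatBlocks kv v (finSigmaFinEquiv (n := kv) p) = v p.1 p.2 := by
  unfold concatBlocks
  generalize hq : (finSigmaFinEquiv (n := kv)).symm (finSigmaFinEquiv (n := kv) p) = q
  rw [Equiv.symm_apply_apply] at hq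
  subst hq
  rfl

/-- A concatenation of blocks `u_j` with `|u_j| = ξ_j` (`k_j ≥ 1` pieces each) is a fragmentation
of `ξ`: `ξ` is a coagulation of it. [cite: FordMaynard2024PrimeSieves, Definition 4.5] -/
theorem isCoagulationOf_concatBlocks {m : ℕ} {kv : Fin m → ℕ} (hkv : ∀ j, 1 ≤ kv j)
    (ξ : Fin m → ℝ) (u : Fin m → ℕ → ℝ) :
    IsCoagulationOf (concatBlocks kv fun j => blockVec (kv j) (ξ j) (u j)) ξ := by
  classical
  refine ⟨fun t => ((finSigmaFinEquiv (n := kv)).symm t).1, fun j => ?_, fun j => ?_⟩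
  · exact ⟨finSigmaFinEquiv (n := kv) ⟨j, ⟨0, hkv j⟩⟩, by simp⟩
  · rw [Finset.sum_filter]
    rw [← (finSigmaFinEquiv (n := kv)).sum_comp]
    simp only [Equiv.symm_apply_apply, concatBlocks_apply_equiv]
    rw [Fintype.sum_sigma]
    rw [Finset.sum_eq_single_of_mem j (Finset.mem_univ j) (fun j' _ hj' => by simp [hj'])]
    simp only [if_true]
    exact (sum_blockVec (hkv j) (ξ j) (u j)).symm

/-- **Which values of `g` enter `fragOp γ η g`**: if `g` and `g'` agree at every vector all of whose
components lie in `[η, 1 − γ)`, then `fragOp γ η g = fragOp γ η g'` — blocks containing a piece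
`≥ 1 − γ` have weight `𝓛_{1−γ} = 0` (Lemma 5.5 (a)). [cite: FordMaynard2024PrimeSieves, §6.1 (remarks after (6.3))] -/
theorem fragIntegrand_congr {γ η : ℝ} {N : ℕ} {g g' : VecFn}
    (h : ∀ (n : ℕ) (w : Fin n → ℝ), (∀ t, η ≤ w t ∧ w t < 1 - γ) → g n w = g' n w)
    {m : ℕ} (kv : Fin m → ℕ) (ξ : Fin m → ℝ) (U : Fin m × Fin N → ℝ) :
    fragIntegrand γ η N g kv ξ U = fragIntegrand γ η N g' kv ξ U := by
  unfold fragIntegrand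
  split_ifs with hc
  · by_cases hsmall : ∀ (j : Fin m) (i : Fin (kv j)), blockVec (kv j) (ξ j) (rowOf U j) i < 1 - γ
    · congr 1
      apply h
      intro t
      obtain ⟨p, rfl⟩ := (finSigmaFinEquiv (n := kv)).surjective t
      rw [concatBlocks_apply_equiv]
      exact ⟨(hc p.1).le_blockVec p.2, hsmall p.1 p.2⟩
    · push Not at hsmall
      obtain ⟨j, i, hi⟩ := hsmall
      have hw : blockWeight γ (kv j) (blockVec (kv j) (ξ j) (rowOf U j)) = 0 := by
        unfold blockWeight
        rw [Literature.Combinatorics.Enumerative.linnikFn_eq_zero_of_mem (1 - γ) _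
          (Finset.mem_univ i) hi (fun k _ => ((hc j).blockVec_pos k).le), zero_div]
      rw [Finset.prod_eq_zero (Finset.mem_univ j) hw, zero_mul, zero_mul]
  · rfl

/-- `fragOp γ η g` depends only on the values of `g` at vectors with all components in
`[η, 1 − γ)` ("one can define `f` arbitrarily on vectors with all components `< 1 − γ`, use (fsl)
to define `f` for other vectors", after Theorem 6.4). [cite: FordMaynard2024PrimeSieves, Theorem 6.4 (remark following it)] -/
theorem fragOp_congr {γ η : ℝ} {g g' : VecFn}
    (h : ∀ (n : ℕ) (w : Fin n → ℝ), (∀ t, η ≤ w t ∧ w t < 1 - γ) → g n w = g' n w) :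
    fragOp γ η g = fragOp γ η g' := by
  funext m ξ
  unfold fragOp
  congr 1
  refine Finset.sum_congr rfl fun kv _ => ?_
  congr 1
  funext U
  exact fragIntegrand_congr h kv ξ U

/-- **Support of `fragOp`.** If `fragOp γ η g (ξ) ≠ 0` then some term of (6.3) has a point where
the integrand is non-zero: block sizes `1 ≤ k_j ≤ ⌊1/η⌋`, admissible blocks, and `g ≠ 0` at the
concatenated fragmentation. [folklore] -/
theorem exists_of_fragOp_ne_zero {γ η : ℝ} {g : VecFn} {m : ℕ} {ξ : Fin m → ℝ}
    (h : fragOp γ η g m ξ ≠ 0) :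
    ∃ (kv : Fin m → ℕ) (U : Fin m × Fin (maxBlock η) → ℝ),
      (∀ j, 1 ≤ kv j ∧ kv j ≤ maxBlock η) ∧
      (∀ j, BlockCond η (maxBlock η) (kv j) (ξ j) (rowOf U j)) ∧
      g (∑ j, kv j) (concatBlocks kv fun j => blockVec (kv j) (ξ j) (rowOf U j)) ≠ 0 := by
  classical
  unfold fragOp at h
  obtain ⟨kv, hkv, hint⟩ := Finset.exists_ne_zero_of_sum_ne_zero (right_ne_zero_of_mul h)
  have hkv' : ∀ j, 1 ≤ kv j ∧ kv j ≤ maxBlock η := fun j => by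
    have := Fintype.mem_piFinset.1 hkv j
    simpa using this
  have : ∃ U, fragIntegrand γ η (maxBlock η) g kv ξ U ≠ 0 := by
    by_contra hU
    push Not at hU
    apply hint
    simp [hU]
  obtain ⟨U, hU⟩ := this
  unfold fragIntegrand at hU
  split_ifs at hU with hc
  · exact ⟨kv, U, hkv', hc, right_ne_zero_of_mul hU⟩
  · exact absurd rfl hU

/-- **Support of `fragOp`, vector form**: if `fragOp γ η g (ξ) ≠ 0` then `ξ` has all components
`≥ η` and is a coagulation of a vector `w` with all components `≥ η` at which `g ≠ 0`.
[cite: FordMaynard2024PrimeSieves, §6.1 (6.3)] -/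
theorem exists_isCoagulationOf_of_fragOp_ne_zero {γ η : ℝ} {g : VecFn} {m : ℕ} {ξ : Fin m → ℝ}
    (h : fragOp γ η g m ξ ≠ 0) :
    (∀ j, η ≤ ξ j) ∧ ∃ (n : ℕ) (w : Fin n → ℝ), g n w ≠ 0 ∧ (∀ t, η ≤ w t) ∧ (∀ t, 0 < w t) ∧
      IsCoagulationOf w ξ := by
  obtain ⟨kv, U, hkv, hc, hg⟩ := exists_of_fragOp_ne_zero h
  have hcoag := isCoagulationOf_concatBlocks (fun j => (hkv j).1) ξ (fun j => rowOf U j)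
  have hη : ∀ t, η ≤ concatBlocks kv (fun j => blockVec (kv j) (ξ j) (rowOf U j)) t := by
    intro t
    obtain ⟨p, rfl⟩ := (finSigmaFinEquiv (n := kv)).surjective t
    rw [concatBlocks_apply_equiv]
    exact (hc p.1).le_blockVec p.2
  have hpos : ∀ t, 0 < concatBlocks kv (fun j => blockVec (kv j) (ξ j) (rowOf U j)) t := by
    intro t
    obtain ⟨p, rfl⟩ := (finSigmaFinEquiv (n := kv)).surjective t
    rw [concatBlocks_apply_equiv]
    exact (hc p.1).blockVec_pos p.2
  refine ⟨fun j => hcoag.le_of_forall_le (fun t => (hpos t).le) hη j, _, _, hg, hη, hpos, hcoag⟩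


/-! ### `fragOp` is the identity on vectors with all components in `[η, 1 − γ)` -/

/-- A term of (6.3) in which a component `ξ_j < 1 − γ` is fragmented into `k_j ≥ 2` pieces
vanishes identically: `𝓛_{1−γ}(u_j) = 𝟙(k_j = 1)` for `|u_j| < 1 − γ` (Lemma 5.5 (b)).
[cite: FordMaynard2024PrimeSieves, §6.1 (remarks after (6.3))] -/
theorem fragIntegrand_eq_zero_of_two_le {γ η : ℝ} {N : ℕ} (g : VecFn) {m : ℕ} {kv : Fin m → ℕ}
    {ξ : Fin m → ℝ} {j : Fin m} (hj : 2 ≤ kv j) (hξ : ξ j < 1 - γ) (U : Fin m × Fin N → ℝ) :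
    fragIntegrand γ η N g kv ξ U = 0 := by
  unfold fragIntegrand
  split_ifs with hc
  · have hw : blockWeight γ (kv j) (blockVec (kv j) (ξ j) (rowOf U j)) = 0 := by
      unfold blockWeight
      have hne : (Finset.univ : Finset (Fin (kv j))).Nonempty :=
        Finset.univ_nonempty_iff.2 ⟨⟨0, by omega⟩⟩
      rw [Literature.Combinatorics.Enumerative.linnikFn_eq_of_sum_lt (1 - γ) _ hne
        (fun k _ => ((hc j).blockVec_pos k).le) (by rw [sum_blockVec (by omega)]; exact hξ)]
      rw [if_neg (by simp only [Finset.card_univ, Fintype.card_fin]; omega), zero_div]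
    rw [Finset.prod_eq_zero (Finset.mem_univ j) hw, zero_mul]
  · rfl

/-- The term of (6.3) with all `k_j = 1` at a vector `ξ` with components in `[η, 1 − γ)`
(`η > 0`): its integrand is the indicator of the dummy box `(0,1)^{Fin m × Fin N}` times the
constant `(∏_j ξ_j⁻¹) · g(ξ)` (weights `𝓛_{1−γ}(ξ_j)/ξ_j = 1/ξ_j` by Lemma 5.5 (b)).
[cite: FordMaynard2024PrimeSieves, §6.1 (remarks after (6.3))] -/
theorem fragIntegrand_one {γ η : ℝ} {N : ℕ} (g : VecFn) {m : ℕ} {ξ : Fin m → ℝ}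
    (h0 : ∀ j, 0 < ξ j) (h1 : ∀ j, η ≤ ξ j) (h2 : ∀ j, ξ j < 1 - γ) (U : Fin m × Fin N → ℝ) :
    fragIntegrand γ η N g (fun _ => 1) ξ U =
      (Set.univ.pi fun _ : Fin m × Fin N => Set.Ioo (0 : ℝ) 1).indicator
        (fun _ => (∏ j, (ξ j)⁻¹) * g (∑ _j : Fin m, 1) (concatBlocks (fun _ => 1) fun j _ => ξ j))
        U := by
  classical
  have hcond : (∀ j : Fin m, BlockCond η N 1 (ξ j) (rowOf U j)) ↔
      U ∈ Set.univ.pi fun _ : Fin m × Fin N => Set.Ioo (0 : ℝ) 1 := by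
    simp only [BlockCond, Set.mem_univ_pi, Set.mem_Ioo, blockVec_one]
    constructor
    · intro h p
      obtain ⟨j, i⟩ := p
      have := (h j).2.2.1 i (Nat.zero_le _) i.2
      simpa [rowOf, i.2] using this
    · intro h j
      refine ⟨fun i hi => by omega, by simpa using h0 j, fun i _ hi => ?_, fun _ => h1 j⟩
      have := h (j, ⟨i, hi⟩)
      simpa [rowOf, hi] using this
  have hw : ∀ j : Fin m, blockWeight γ 1 (blockVec 1 (ξ j) (rowOf U j)) = (ξ j)⁻¹ := by
    intro j
    rw [blockVec_one]
    unfold blockWeight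
    rw [Literature.Combinatorics.Enumerative.linnikFn_eq_of_sum_lt (1 - γ) _
      (Finset.univ_nonempty_iff.2 ⟨0⟩) (fun _ _ => (h0 j).le) (by simpa using h2 j)]
    simp
  have hv : (fun j => blockVec 1 (ξ j) (rowOf U j)) = fun j (_ : Fin 1) => ξ j := by
    funext j; rw [blockVec_one]
  unfold fragIntegrand
  by_cases hU : U ∈ Set.univ.pi fun _ : Fin m × Fin N => Set.Ioo (0 : ℝ) 1
  · rw [if_pos (hcond.2 hU), Set.indicator_of_mem hU, Finset.prod_congr rfl fun j _ => hw j, hv]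
  · rw [if_neg (fun h => hU (hcond.1 h)), Set.indicator_of_notMem hU]

/-- With all blocks of size `1`, the enumeration `finSigmaFinEquiv` sends `⟨j, 0⟩` to `j`.
[folklore] -/
theorem val_finSigmaFinEquiv_const_one {m : ℕ} (p : (_ : Fin m) × Fin 1) :
    (finSigmaFinEquiv (n := fun _ : Fin m => 1) p : ℕ) = p.1 := by
  rw [finSigmaFinEquiv_apply]
  simp only [Finset.sum_const, Finset.card_univ, Fintype.card_fin, smul_eq_mul, mul_one,
    Fin.val_eq_zero p.2, add_zero]

/-- The concatenation of the one-piece blocks `(ξ_j)` is `ξ` (re-indexed along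
`Fin (∑_j 1) = Fin m`). [folklore] -/
theorem concatBlocks_const_one {m : ℕ} (ξ : Fin m → ℝ) (t : Fin (∑ _j : Fin m, 1)) :
    concatBlocks (fun _ => 1) (fun j _ => ξ j) t = ξ (Fin.cast (by simp) t) := by
  set j : Fin m := Fin.cast (by simp) t with hj
  have het : finSigmaFinEquiv (n := fun _ : Fin m => 1) ⟨j, 0⟩ = t := by
    apply Fin.ext
    rw [val_finSigmaFinEquiv_const_one]
    simp [j]
  unfold concatBlocks
  rw [← het, Equiv.symm_apply_apply]

/-- **`fragOp γ η g` extends `g`**: at a vector `ξ` all of whose components lie in `[η, 1 − γ)`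
(`0 < η ≤ 1`), `fragOp γ η g (ξ) = g(ξ)` — in (6.3) only the term with all `k_j = 1` survives
(Lemma 5.5 (b)). [cite: FordMaynard2024PrimeSieves, §6.1 (remarks after (6.3))] -/
theorem fragOp_apply_of_small {γ η : ℝ} (hη : 0 < η) (hη1 : η ≤ 1) (g : VecFn) {m : ℕ}
    {ξ : Fin m → ℝ} (h1 : ∀ j, η ≤ ξ j) (h2 : ∀ j, ξ j < 1 - γ) : fragOp γ η g m ξ = g m ξ := by
  classical
  have h0 : ∀ j, 0 < ξ j := fun j => hη.trans_le (h1 j)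
  have hN : 1 ≤ maxBlock η := by
    unfold maxBlock
    refine Nat.le_floor ?_
    rw [Nat.cast_one, le_div_iff₀ hη]
    linarith
  unfold fragOp
  have hmem : (fun _ : Fin m => 1) ∈ Fintype.piFinset (fun _ : Fin m => Finset.Icc 1 (maxBlock η)) :=
    Fintype.mem_piFinset.2 fun _ => Finset.mem_Icc.2 ⟨le_rfl, hN⟩
  rw [Finset.sum_eq_single_of_mem (fun _ : Fin m => 1) hmem ?_]
  · rw [show (fun U => fragIntegrand γ η (maxBlock η) g (fun _ : Fin m => 1) ξ U) = _ from
      funext (fragIntegrand_one g h0 h1 h2)]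
    rw [integral_indicator_const _ (MeasurableSet.univ_pi fun _ => measurableSet_Ioo),
      measureReal_def, volume_pi_pi]
    simp only [Real.volume_Ioo, sub_zero, ENNReal.ofReal_one, Finset.prod_const_one,
      ENNReal.toReal_one, one_smul]
    rw [← mul_assoc, ← Finset.prod_mul_distrib,
      Finset.prod_congr rfl fun j _ => mul_inv_cancel₀ (h0 j).ne', Finset.prod_const_one, one_mul]
    exact VecFn.apply_congr g (by simp) _ _ (concatBlocks_const_one ξ)
  · intro kv hkv hne
    have : ∃ j, 2 ≤ kv j := by
      by_contra hall
      push Not at hall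
      apply hne
      funext j
      have := (Finset.mem_Icc.1 (Fintype.mem_piFinset.1 hkv j)).1
      have := hall j
      omega
    obtain ⟨j, hj⟩ := this
    simp [fragIntegrand_eq_zero_of_two_le g hj (h2 j)]

/-- In particular the fragmentation relation holds automatically at vectors with all components
in `[η, 1 − γ)`; its content is (fsl), at vectors with a component `≥ 1 − γ`.
[cite: FordMaynard2024PrimeSieves, Theorem 6.4] -/
theorem fragRel_apply_of_small {γ η : ℝ} (hη : 0 < η) (hη1 : η ≤ 1) (f : VecFn) {m : ℕ}
    {ξ : Fin m → ℝ} (h1 : ∀ j, η ≤ ξ j) (h2 : ∀ j, ξ j < 1 - γ) : f m ξ = fragOp γ η f m ξ :=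
  (fragOp_apply_of_small hη hη1 f h1 h2).symm

end Literature.NumberTheory.Sieve.FordMaynard
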